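import Summits.FinalStateConjecture.FinalStateConjecture.Theorems.ZeroEnergyKerrOrBombStationaryLimitReductionStubChartTransfer
import Summits.FinalStateConjecture.FinalStateConjecture.Theorems.ZeroEnergyKerrOrBombSymplecticDualOfTheBombSig4
import Summits.FinalStateConjecture.FinalStateConjecture.Theorems.ZeroEnergyKerrOrBombStationaryLimitReductionRecutSets
import Summits.FinalStateConjecture.FinalStateConjecture.Statement
import Literature.Geometry.Lorentzian.CausalityPushUp
import Literature.Geometry.Lorentzian.KerrSchildFrame
import Literature.Geometry.Lorentzian.KerrFluxComparison
import HarnessLib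

/-!
# Route ZeroEnergyKerrOrBomb · crux `FinalStateFromKerrOrBomb` (stmt-FinalStateConjecture-17839), line `SketchIdeator1` —
# stub `stub_chartTransferT2`: the chart transfer carried to the RE-TYPED summit

Helper file (`--supports stmt-FinalStateConjecture-17839`; registered helper `chartTransferT2_unfolded`) of the lead's
wave-1 stub worker (2026-08-17). The statement module `…Sig7` is not built yet, so the registered stub
`stub_chartTransferT2 : Sig7.stub_chartTransferT2` is landed UNFOLDED (its body, `IsOrientationCompatible 𝒟 d` replaced by
its three clauses); the lead closes the skeleton stub by `exact`. The witness is the recut decomposition of the landed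
`stub_chartTransferGeneral` (p121011/p130371, proof re-run); the two clauses the re-typed summit (p126844) added come from:
§1 `causalPast_subset_chronologicalPast` (past push-up for sets, O'Neill 1983, Ch. 14, Cor. 14.1, from the tree's
`mem_chronologicalFuture_of_mem_causalFuture` by time reversal) and `raysStayInClosure_mono`; §2
`inter_chronologicalPast_docCharted_subset_exteriorOf_recutCharted`: `O ∩ I⁻(docCharted d) ⊆ exteriorOf 𝒟 (recutCharted τ₁)`
— a point of the self-determined d.o.c. leaves every certified late region, so clause (ii) of `HasExhaustiveDocCharts'` at a
late chart time puts it causally before a flat point of time `> τ₁` or (anchor `Θᵢ '' exterior = Aᵢ⁻¹ doc` + tilt bound) a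
recut chart point of Kerr–Schild time `> τ₁`; such points lie in OPEN pieces of `recutCharted τ₁` and in `O ⊆ I⁻(d.charted)`,
hence in `I⁻(recutCharted τ₁)` (`mem_chronologicalPast_of_isOpen`), and push-up concludes; §3 eventual TIMELIKENESS of the
push-forwards `IsFutureOriented` inspects, from the `C⁰` part of the convergence (`g(dψ w, dψ w) ≤ g₀(w, w) + ε‖w‖²`;
`η(∂₀, ∂₀) = −1`; `g_{M,a}(V, V) = −1 − 2H ≤ −1`, `‖V‖ ≤ 5`). Elementary; no named fact, nothing restated. References:
Dafermos–Luk arXiv:1710.01722, Conjecture 1 (b)–(c); O'Neill 1983, Ch. 14, Cor. 14.1; Dafermos–Rodnianski arXiv:0811.0354, §5.1.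
-/

-- every `Summit.FinalStateConjecture.FinalStateConjecture.…` name repeats the summit = sub-problem segment (D-0017 layout)
set_option linter.dupNamespace false

noncomputable section

open scoped Manifold ContDiff Topology ENNReal
open Set Filter Function Literature.Geometry.Lorentzian

namespace Summit.FinalStateConjecture.FinalStateConjecture.Theorems.SymplecticDualOfTheBomb

open Summit.FinalStateConjecture.FinalStateConjecture.Theorems.OneLockedExplosion

/-! ## §1 Past push-up for sets; monotonicity of the ray clause -/

section PushUp

variable {E : Type*} [NormedAddCommGroup E] [NormedSpace ℝ E] [FiniteDimensional ℝ E] {H : Type*}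
  [TopologicalSpace H] {I : ModelWithCorners ℝ E H} {n : ℕ∞ω} {M : Type*} [TopologicalSpace M]
  [ChartedSpace H M] [IsManifold I ∞ M] [BoundarylessManifold I M] {g : LorentzianMetric I n M}
  {τ : TimeOrientation g}

/-- **Past push-up for sets**: `S ⊆ I⁻(U)` implies `J⁻(S) ⊆ I⁻(U)` (`x ≪ y ≤ z ⟹ x ≪ z` read for the reversed orientation,
from `LorentzianMetric.mem_chronologicalFuture_of_mem_causalFuture` for `τ.reverse.reverse`), `n ≥ 1`. [cite: ONeill1983, Ch. 14, Cor. 14.1] -/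
theorem causalPast_subset_chronologicalPast (hn : 1 ≤ n) {S U : Set M} (hS : S ⊆ g.chronologicalPast τ U) :
    g.causalPast τ S ⊆ g.chronologicalPast τ U := by
  rintro p (hp | ⟨q, hq, γ, a, b, hab, hγ, hγa, hγb⟩)
  · exact hS hp
  · obtain ⟨u, hu, β, a', b', hab', hβ, hβa, hβb⟩ := hS hq
    have hqp : q ∈ g.causalFuture τ.reverse.reverse {p} :=
      Or.inr ⟨p, rfl, fun t ↦ γ (a + b - t), a, b, hab, hγ.reverseParam, by simp [hγb], by simp [hγa]⟩
    have hqu : u ∈ g.chronologicalFuture τ.reverse.reverse {q} :=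
      LorentzianMetric.mem_chronologicalPast_of_mem_chronologicalFuture ⟨u, rfl, β, a', b', hab', hβ, hβa, hβb⟩
    exact LorentzianMetric.chronologicalFuture_mono (singleton_subset_iff.2 hu)
      (LorentzianMetric.mem_chronologicalFuture_of_mem_chronologicalPast
        (LorentzianMetric.mem_chronologicalFuture_of_mem_causalFuture hn hqp hqu))

end PushUp

section Rays

variable {X : Type} [TopologicalSpace X] [ChartedSpace E3 X] [IsManifold (𝓡 3) ∞ X] [ConnectedSpace X]
  {D : InitialDataSet (𝓡 3) X}

/-- The summit's ray clause `RaysStayInClosure 𝒟 O` is monotone in `O` (`closure` is monotone). [folklore] -/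
theorem raysStayInClosure_mono (𝒟 : CauchyDevelopment D) {A B : Set 𝒟.carrier} (hAB : A ⊆ B)
    (h : Summit.FinalStateConjecture.RaysStayInClosure 𝒟 A) : Summit.FinalStateConjecture.RaysStayInClosure 𝒟 B := by
  intro _ p γ dom hγ hdom t ht h0
  exact closure_mono hAB (h p γ dom hγ hdom t ht h0)

/-! ## §2 The self-determined d.o.c. lies in the recut exterior -/

/-- **`O ∩ I⁻(docCharted d) ⊆ exteriorOf 𝒟 (recutCharted d M a Θ τ₁)`** for a stationary decomposition `d` of the honest
exterior, exhaustive in the d.o.c. sense, with Kerr identifications of tilt `≤ Lᵢ`, and a recut time `τ₁ ≥ τ₀` at which the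
recut hole charts and the flat chart are late charts into `O` (module docstring, §2). [cite: DafermosLuk2017, Conjecture 1 (b)–(c)] -/
theorem inter_chronologicalPast_docCharted_subset_exteriorOf_recutCharted (𝒟 : CauchyDevelopment D)
    {O : Set 𝒟.carrier} {k : ℕ} (d : StationaryFinalStateDecomposition 𝒟.toSpacetime O k)
    {M a c r₀ : Fin d.N → ℝ} {Θ : Fin d.N → E4 → E4} (hO : O = Summit.FinalStateConjecture.exteriorOf 𝒟 d.charted)
    (hex : HasExhaustiveDocCharts' d) (hK : ∀ i, IsKerrChartedWith (d.hole i) (d.adapted i) (M i) (a i) (c i) (r₀ i) (Θ i))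
    (hmaps : ∀ i, MapsTo (recutMap (d.motion i).1 (d.motion i).2 (Θ i))
      ((recutBackground d M a i).domain : Set E4) ((d.background i).domain : Set E4))
    {L : Fin d.N → ℝ} (hL : ∀ i, ∀ u ∈ (Kerr.exterior (M i) (a i) : Set E4), |Θ i u 0 - c i * u 0| ≤ L i)
    {τ₁ : ℝ} (hτ₀τ₁ : d.toOver.τ₀ ≤ τ₁)
    (hlate : ∀ i, 𝒟.toSpacetime.IsLateChart (recutBackground d M a i) O τ₁ (recutChart d M a Θ hmaps i))
    (hflat : 𝒟.toSpacetime.IsLateChart (Minkowski.backgroundOn d.toOver.flatDomain) O τ₁ d.toOver.flatChart) :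
    O ∩ 𝒟.metric.chronologicalPast 𝒟.timeOrientation (docCharted d) ⊆
      Summit.FinalStateConjecture.exteriorOf 𝒟 (recutCharted d M a Θ τ₁) := by
  classical
  obtain ⟨R, -, -, -, -, hii⟩ := hex
  rintro p ⟨hpO, hpI⟩
  refine ⟨by rw [hO] at hpO; exact hpO.1, ?_⟩
  -- points of `O` in an open piece of `recutCharted τ₁` are chronologically before it
  have hOI : ∀ q ∈ O, ∀ U : Set 𝒟.carrier, IsOpen U → q ∈ U → U ⊆ recutCharted d M a Θ τ₁ →
      q ∈ 𝒟.metric.chronologicalPast 𝒟.timeOrientation (recutCharted d M a Θ τ₁) := fun q hq U hU hqU hUsub ↦ by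
    rw [hO] at hq
    exact LorentzianMetric.chronologicalFuture_mono hUsub (mem_chronologicalPast_of_isOpen hq.2 hU hqU)
  -- a late enough chart time `τ`: beyond `T(p)`, `τ₁` and every `cᵢ τ₁ + Lᵢ`
  obtain ⟨T, hT₀, hT⟩ := exists_forall_not_mem_certifiedLate d.toOver R p
  obtain ⟨T', hT'⟩ := Finite.exists_le fun i ↦ c i * τ₁ + L i
  set τ : ℝ := max T (max T' τ₁) + 1 with hτ
  have hτT' : ∀ i, c i * τ₁ + L i < τ := fun i ↦ ((hT' i).trans ((le_max_left _ _).trans (le_max_right _ _))).trans_lt (lt_add_one _)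
  have hττ₁ : τ₁ < τ := ((le_max_right _ _).trans (le_max_right _ _)).trans_lt (lt_add_one _)
  have hττ₀ : d.toOver.τ₀ < τ := hτ₀τ₁.trans_lt hττ₁
  -- `p` is causally before the d.o.c.-certified slab at `τ`, which is chronologically before `recutCharted τ₁`
  have hpslab : p ∈ 𝒟.metric.causalPast 𝒟.timeOrientation (docCertifiedSlab d R τ) := hii τ hττ₀
    ⟨⟨hpO, hpI⟩, fun h ↦ hT τ ((le_max_left _ _).trans (lt_add_one _).le) (docCertifiedLate_subset_certifiedLate d R τ h)⟩
  refine causalPast_subset_chronologicalPast (by exact_mod_cast le_top) (fun q hq ↦ ?_) hpslab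
  rcases hq with ⟨y, hy, rfl⟩ | hq
  · -- a flat slab point of time `τ > τ₁`
    have hy' : (y : E4) 0 = τ := hy
    have hy₁ : y ∈ (Minkowski.backgroundOn d.toOver.flatDomain).lateRegion τ₁ := by show τ₁ < (y : E4) 0; rw [hy']; exact hττ₁
    refine hOI _ (hflat.image_subset ⟨y, hy₁, rfl⟩) _ (isOpen_image_of_isLateChart hflat) ⟨y, hy₁, rfl⟩ ?_
    rw [recutCharted_eq d M a Θ hmaps]
    exact subset_union_left
  · -- a d.o.c. hole slab point `ψᵢ x`, `P⁻¹ x = Θᵢ u`: the recut chart point of `z = P u`, Kerr–Schild time `u⁰ > τ₁`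
    obtain ⟨i, hi⟩ := mem_iUnion.1 hq
    obtain ⟨x, ⟨hxs, hxd⟩, rfl⟩ := hi
    obtain ⟨u, hu, hux⟩ : poincareInv (d.motion i).1 (d.motion i).2 x.1 ∈ Θ i '' (Kerr.exterior (M i) (a i) : Set E4) := by
      rw [(hK i).2.2.2.2.2.2.2.2.2.1]; exact hxd
    have hx0 : (poincareInv (d.motion i).1 (d.motion i).2 x.1) 0 = τ := hxs.1
    have hu0 : τ₁ < u 0 := by
      have h1 := (abs_le.1 (hL i u hu)).2
      rw [hux, hx0] at h1
      have h2 : c i * τ₁ < c i * u 0 := by linarith [hτT' i]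
      exact lt_of_mul_lt_mul_left h2 (hK i).2.1.le
    set z : E4 := ((d.motion i).1 : E4 ≃L[ℝ] E4) u + (d.motion i).2 with hz_def
    have hz : z ∈ ((recutBackground d M a i).domain : Set E4) := by
      show poincareInv (d.motion i).1 (d.motion i).2 z ∈ (Kerr.exterior (M i) (a i) : Set E4)
      rw [hz_def, poincareInv_apply_add]; exact hu
    have hzlate : (⟨z, hz⟩ : (recutBackground d M a i).domain) ∈ (recutBackground d M a i).lateRegion τ₁ := by
      show τ₁ < (poincareInv (d.motion i).1 (d.motion i).2 z) 0
      rw [hz_def, poincareInv_apply_add]; exact hu0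
    have hqeq : recutChart d M a Θ hmaps i ⟨z, hz⟩ = d.toOver.chart i x := by
      show d.toOver.chart i _ = d.toOver.chart i x
      congr 1; apply Subtype.ext
      show ((d.motion i).1 : E4 ≃L[ℝ] E4) (Θ i (poincareInv (d.motion i).1 (d.motion i).2 z)) + (d.motion i).2 = x.1
      rw [hz_def, poincareInv_apply_add, hux, apply_poincareInv_add]
    have hxlate : x ∈ (d.background i).lateRegion d.toOver.τ₀ := by
      show d.toOver.τ₀ < (poincareInv (d.motion i).1 (d.motion i).2 x.1) 0
      rw [hx0]; exact hττ₀
    refine hOI _ ((d.toOver.isLateChart i).image_subset ⟨x, hxlate, rfl⟩) _ (isOpen_image_of_isLateChart (hlate i))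
      ⟨⟨z, hz⟩, hzlate, hqeq⟩ ?_
    rw [recutCharted_eq d M a Θ hmaps]
    exact subset_union_of_subset_right
      (subset_iUnion (fun j ↦ recutChart d M a Θ hmaps j '' (recutBackground d M a j).lateRegion τ₁) i) _

end Rays

/-! ## §3 Eventual timelikeness of the inspected push-forwards from the `C⁰` convergence -/

section Timelike

variable (𝓢 : Spacetime.{0} 4)

/-- **`C⁰`-closeness controls the pulled-back metric pointwise**: if the `Cᵏ` deviation of `ψ^* g` from `g₀` on the truncated
slab `{t = τ, r ≤ R}` is `< ε`, then at every `x` of the slab, `g(dψ w, dψ w) ≤ g₀(x)(w, w) + ε ‖w‖²`. [folklore] -/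
theorem val_mfderiv_le_of_truncDeviationCk_lt (B : ModelBackground) (ψ : B.domain → 𝓢.carrier) {k : ℕ} {R τ ε : ℝ}
    (hε : 0 < ε) (h : 𝓢.truncDeviationCk B ψ k R τ < ENNReal.ofReal ε) {x : B.domain} (hx : x ∈ B.truncTimeSlab R τ)
    (w : E4) : 𝓢.metric.val (ψ x) (mfderiv 𝓘(ℝ, E4) (𝓡 4) ψ x w) (mfderiv 𝓘(ℝ, E4) (𝓡 4) ψ x w) ≤
      B.bilin x.1 w w + ε * (‖w‖ * ‖w‖) := by
  have h1 : ‖𝓢.deviation B ψ x‖ < ε := by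
    have h2 := enorm_iteratedFDeriv_le_supCkENorm (Nat.zero_le k) (mem_image_of_mem Subtype.val hx) (𝓢.deviationExtend B ψ)
    rw [← ofReal_norm, norm_iteratedFDeriv_zero, 𝓢.deviationExtend_coe] at h2
    exact (ENNReal.ofReal_lt_ofReal_iff hε).1 (h2.trans_lt h)
  have h3 : |𝓢.deviation B ψ x w w| ≤ ‖𝓢.deviation B ψ x‖ * ‖w‖ * ‖w‖ := by
    rw [← Real.norm_eq_abs]; exact (𝓢.deviation B ψ x).le_opNorm₂ w w
  have h4 := 𝓢.deviation_apply B ψ x w w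
  have h6 : ‖𝓢.deviation B ψ x‖ * ‖w‖ * ‖w‖ ≤ ε * (‖w‖ * ‖w‖) := by
    rw [mul_assoc]; exact mul_le_mul_of_nonneg_right h1.le (mul_nonneg (norm_nonneg w) (norm_nonneg w))
  linarith [(abs_le.1 h3).2]

/-- **Flat slabs: `dΨ₀(∂₀)` is eventually timelike** when the `Cᵏ` deviation of `Ψ₀^* g` from `η` tends to `0`. [folklore] -/
theorem eventually_isTimelike_flat {U : TopologicalSpace.Opens E4} (ψ : (Minkowski.backgroundOn U).domain → 𝓢.carrier)
    {k : ℕ} (h : Tendsto (fun τ ↦ 𝓢.deviationCk (Minkowski.backgroundOn U) ψ k τ) atTop (𝓝 0)) :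
    ∀ᶠ τ in atTop, ∀ y ∈ (Minkowski.backgroundOn U).timeSlab τ,
      𝓢.metric.IsTimelike (mfderiv 𝓘(ℝ, E4) (𝓡 4) ψ y (E4.basisVector 0)) := by
  have hε : (0 : ℝ) < 1 / 2 := by norm_num
  filter_upwards [h.eventually (gt_mem_nhds (ENNReal.ofReal_pos.2 hε))] with τ hτ y hy
  have hy' : y ∈ (Minkowski.backgroundOn U).truncTimeSlab ((Minkowski.backgroundOn U).radius y.1) τ := ⟨hy, le_rfl⟩
  have h2 := val_mfderiv_le_of_truncDeviationCk_lt 𝓢 (Minkowski.backgroundOn U) ψ hε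
    ((𝓢.truncDeviationCk_le_deviationCk (Minkowski.backgroundOn U) ψ k _ τ).trans_lt hτ) hy' (E4.basisVector 0)
  have h3 : (Minkowski.backgroundOn U).bilin y.1 (E4.basisVector 0) (E4.basisVector 0) = -1 :=
    Minkowski.bilin_basisVector_zero
  have h4 : ‖E4.basisVector 0‖ = 1 := by simp [E4.basisVector]
  rw [h3, h4] at h2
  exact h2.trans_lt (by norm_num)

/-- `‖V_{M,a}(u)‖ ≤ 5` on the sub-extremal Kerr exterior: `V = ∂₀ − 2H ℓ♯`, `0 ≤ H ≤ 1` (`Kerr.scalarH_le_one`), `‖ℓ♯‖² = 2`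
(`Kerr.norm_nullVector_sq`). Dafermos–Rodnianski arXiv:0811.0354, §5.1. [folklore] -/
theorem norm_timeVector_le {M a : ℝ} (hMa : Kerr.IsSubextremal M a) {u : E4} (hu : u ∈ (Kerr.exterior M a : Set E4)) :
    ‖Kerr.timeVector M a u‖ ≤ 5 := by
  have hr : 0 < Kerr.radius a u := Kerr.radius_pos_of_mem_region hu
  have hH0 : 0 ≤ Kerr.scalarH M a u := Kerr.scalarH_nonneg hMa.pos.le a u
  have hH1 : Kerr.scalarH M a u ≤ 1 := Kerr.scalarH_le_one hMa hu
  have hℓ : ‖Kerr.nullVector a u‖ ≤ 2 := by nlinarith [Kerr.norm_nullVector_sq hr (a := a), norm_nonneg (Kerr.nullVector a u)]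
  have h4 : ‖E4.basisVector 0‖ = 1 := by simp [E4.basisVector]
  calc ‖Kerr.timeVector M a u‖ ≤ ‖E4.basisVector 0‖ + ‖(2 * Kerr.scalarH M a u) • Kerr.nullVector a u‖ := norm_sub_le _ _
    _ = 1 + 2 * Kerr.scalarH M a u * ‖Kerr.nullVector a u‖ := by
        rw [h4, norm_smul, Real.norm_eq_abs, abs_of_nonneg (by linarith)]
    _ ≤ 5 := by nlinarith

/-- **Boosted Kerr–Schild slabs: the push-forward of `Λ V_{M,a}` is eventually timelike** when the `Cᵏ` deviation of `ψ^* g`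
from boosted Kerr (`|a| < M`) on the truncated slabs tends to `0`: `g_{M,a}(V, V) = −1 − 2H ≤ −1`, `‖Λ V‖ ≤ 5‖Λ‖`. [folklore] -/
theorem eventually_isTimelike_boostedKerr {Λ : lorentzGroup} {c₀ : E4} {M a : ℝ} (hMa : Kerr.IsSubextremal M a)
    (ψ : (boostedKerrBackground Λ c₀ M a).domain → 𝓢.carrier) {k : ℕ} (ρ : ℝ)
    (h : Tendsto (fun τ ↦ 𝓢.truncDeviationCk (boostedKerrBackground Λ c₀ M a) ψ k ρ τ) atTop (𝓝 0)) :
    ∀ᶠ τ in atTop, ∀ x ∈ (boostedKerrBackground Λ c₀ M a).truncTimeSlab ρ τ, 𝓢.metric.IsTimelike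
      (mfderiv 𝓘(ℝ, E4) (𝓡 4) ψ x ((Λ : E4 ≃L[ℝ] E4) (Kerr.timeVector M a (poincareInv Λ c₀ x.1)))) := by
  set K : ℝ := ‖((Λ : E4 ≃L[ℝ] E4) : E4 →L[ℝ] E4)‖ with hK
  have hK0 : 0 ≤ K := norm_nonneg _
  set ε : ℝ := 1 / ((5 * K) ^ 2 + 1) with hε_def
  have hε : 0 < ε := by positivity
  have hε1 : ε * ((5 * K) ^ 2) < 1 := by
    rw [hε_def, div_mul_eq_mul_div, one_mul, div_lt_one (by positivity)]; linarith
  filter_upwards [h.eventually (gt_mem_nhds (ENNReal.ofReal_pos.2 hε))] with τ hτ x hx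
  have hu : poincareInv Λ c₀ x.1 ∈ (Kerr.exterior M a : Set E4) := mem_boostedKerrExterior.1 x.2
  have hr : 0 < Kerr.radius a (poincareInv Λ c₀ x.1) := Kerr.radius_pos_of_mem_region hu
  have hV := norm_timeVector_le hMa hu
  have hw : ‖(Λ : E4 ≃L[ℝ] E4) (Kerr.timeVector M a (poincareInv Λ c₀ x.1))‖ ≤ 5 * K := by
    have h1 := ((Λ : E4 ≃L[ℝ] E4) : E4 →L[ℝ] E4).le_opNorm (Kerr.timeVector M a (poincareInv Λ c₀ x.1))
    rw [ContinuousLinearEquiv.coe_coe] at h1; nlinarith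
  have h2 := val_mfderiv_le_of_truncDeviationCk_lt 𝓢 (boostedKerrBackground Λ c₀ M a) ψ hε hτ hx
    ((Λ : E4 ≃L[ℝ] E4) (Kerr.timeVector M a (poincareInv Λ c₀ x.1)))
  have h3 : (boostedKerrBackground Λ c₀ M a).bilin x.1 ((Λ : E4 ≃L[ℝ] E4) (Kerr.timeVector M a (poincareInv Λ c₀ x.1)))
      ((Λ : E4 ≃L[ℝ] E4) (Kerr.timeVector M a (poincareInv Λ c₀ x.1))) = -1 - 2 * Kerr.scalarH M a (poincareInv Λ c₀ x.1) := by
    show boostedKerrBilin Λ c₀ M a x.1 _ _ = _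
    rw [boostedKerrBilin_apply, ContinuousLinearEquiv.symm_apply_apply, Kerr.bilin_timeVector_timeVector hr]
  rw [h3] at h2
  have h4 : ε * (‖(Λ : E4 ≃L[ℝ] E4) (Kerr.timeVector M a (poincareInv Λ c₀ x.1))‖ *
      ‖(Λ : E4 ≃L[ℝ] E4) (Kerr.timeVector M a (poincareInv Λ c₀ x.1))‖) ≤ ε * ((5 * K) ^ 2) :=
    mul_le_mul_of_nonneg_left (by nlinarith [norm_nonneg ((Λ : E4 ≃L[ℝ] E4) (Kerr.timeVector M a (poincareInv Λ c₀ x.1)))]) hε.le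
  exact h2.trans_lt (by linarith [Kerr.scalarH_nonneg hMa.pos.le a (poincareInv Λ c₀ x.1)])

end Timelike

/-! ## §4 The stub, unfolded: `chartTransferT2_unfolded` -/

/-- **Stub `stub_chartTransferT2` of line `SketchIdeator1` (crux stmt-FinalStateConjecture-17839) = `Sig7.stub_chartTransferT2`
UNFOLDED** (`IsOrientationCompatible 𝒟 d` replaced by its body): the chart transfer in general position with the RE-TYPED
summit's per-datum conclusion. `d'` is the recut decomposition of `stub_chartTransferGeneral` (proof re-run: late time `τ₁`,
honest radii); the ray clause transfers along `O ∩ I⁻(docCharted d) ⊆ O'` (§2, `raysStayInClosure_mono`); `IsFutureOriented d'`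
by orthochronous motions, the orientation clauses of `d`, future-preservation of the `Θᵢ`, and §3 (chain rule
`d(ψᵢ ∘ recutMap Θᵢ)(Λ V) = dψᵢ(Λ dΘᵢ V)` by `mfderiv_readapt`, `fderiv_conj`). [cite: DafermosLuk2017, Conjecture 1 (b)–(c)] -/
theorem chartTransferT2_unfolded : ∀ (X : Type) [TopologicalSpace X] [ChartedSpace E3 X] [IsManifold (𝓡 3) ∞ X] [T2Space X] [SecondCountableTopology X] [ConnectedSpace X] (D : InitialDataSet (𝓡 3) X) (𝒟 : VacuumCauchyDevelopment D) (O : Set 𝒟.carrier) (d : StationaryFinalStateDecomposition 𝒟.toSpacetime O 2) (M a c r₀ : Fin d.N → ℝ) (Θ : Fin d.N → E4 → E4), O = Summit.FinalStateConjecture.exteriorOf 𝒟.toCauchyDevelopment d.charted → HasExhaustiveDocCharts' d → IsHorizonNormalised d → (∀ i, IsKerrChartedWith (d.hole i) (d.adapted i) (M i) (a i) (c i) (r₀ i) (Θ i)) → (∀ i, ∀ u ∈ (Kerr.exterior (M i) (a i) : Set E4), ∀ h : Θ i u ∈ (d.adapted i).domain, (d.hole i).timeOrientation.IsFutureDirected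 (mfderiv 𝓘(ℝ, E4) (𝓡 4) (d.adapted i).toFun ⟨Θ i u, h⟩ (fderiv ℝ (Θ i) u (Kerr.timeVector (M i) (a i) u)))) → KerrSchildRecutCovering 𝒟 d M a Θ → Summit.FinalStateConjecture.RaysStayInClosure 𝒟.toCauchyDevelopment (O ∩ 𝒟.metric.chronologicalPast 𝒟.timeOrientation (docCharted d)) → ((∀ i, Summit.FinalStateConjecture.IsOrthochronous (d.motion i).1) ∧ (∀ (i : Fin d.N) (y : (d.background i).domain) (w : E4), d.toOver.τ₀ < (d.background i).time y.1 → (d.hole i).timeOrientation.IsFutureDirected (mfderiv 𝓘(ℝ, E4) (𝓡 4) (d.adapted i).toFun ⟨poincareInv (d.motion i).1 (d.motion i).2 y.1, ModelBackground.mem_boost_domain.1 y.2⟩ (((d.motion i).1 : E4 ≃L[ℝ] E4).symm w)) → 𝒟.metric.IsTimelike (mfderiv 𝓘(ℝ, E4) (𝓡 4) (d.toOver.chart i) y w) → 𝒟.timeOrientation.IsFutureDirected (mfderiv 𝓘(ℝ, E4) (𝓡 4) (d.toOver.chart i) y w)) ∧ ∀ y : d.toOver.flatDomain, d.toOver.τ₀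 < (y : E4) 0 → 𝒟.metric.IsTimelike (mfderiv 𝓘(ℝ, E4) (𝓡 4) d.toOver.flatChart y (E4.basisVector 0)) → 𝒟.timeOrientation.IsFutureDirected (mfderiv 𝓘(ℝ, E4) (𝓡 4) d.toOver.flatChart y (E4.basisVector 0))) → ∃ (O' : Set 𝒟.carrier) (d' : FinalStateDecomposition 𝒟.toSpacetime O' 2), (∀ i, Kerr.IsSubextremal (d'.mass i) (d'.spin i)) ∧ O' = Summit.FinalStateConjecture.exteriorOf 𝒟.toCauchyDevelopment d'.charted ∧ Summit.FinalStateConjecture.RaysStayInClosure 𝒟.toCauchyDevelopment O' ∧ Summit.FinalStateConjecture.HasExhaustiveCharts d' ∧ Summit.FinalStateConjecture.IsFutureOriented d' := by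
  intro X _ _ _ _ _ _ D 𝒟 O d M a c r₀ Θ hO hex _ hK hF5 hG hrays horient
  -- the clauses of `IsKerrChartedWith`
  have hsub := fun i ↦ (hK i).1
  have hc := fun i ↦ (hK i).2.1
  have hr₀ := fun i ↦ (hK i).2.2.2.1
  have hΘs := fun i ↦ (hK i).2.2.2.2.1
  have hinj := fun i ↦ (hK i).2.2.2.2.2.1
  have hΘm := fun i ↦ (hK i).2.2.2.2.2.2.1
  have hΘe := fun i ↦ (hK i).2.2.2.2.2.2.2.1
  have hiso := fun i ↦ (hK i).2.2.2.2.2.2.2.2.1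
  have hsubreg : ∀ i, (Kerr.exterior (M i) (a i) : Set E4) ⊆ (Kerr.region (a i) (r₀ i) : Set E4) :=
    fun i z hz ↦ Kerr.mem_region.2 ((max_le_max (hr₀ i).le le_rfl).trans_lt (Kerr.mem_exterior.1 hz))
  -- the recut maps carry the boosted exteriors into the moved adapted domains
  have hmaps : ∀ i, MapsTo (recutMap (d.motion i).1 (d.motion i).2 (Θ i))
      ((recutBackground d M a i).domain : Set E4) ((d.background i).domain : Set E4) := fun i x hx ↦
    mapsTo_conj (d.motion i).1 (d.motion i).2 (hΘm i) (hsubreg i (mem_boostedKerrExterior.1 hx))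
  obtain ⟨τ₀', R', hτ₀', hR', hconv, -, hii⟩ := hG hmaps
  -- tilt bounds and the new late time `τ₁`
  choose L hL using fun i ↦ kerrChartedWith_tilt_bound _ _ _ _ _ _ _ (hK i)
  obtain ⟨T, hT⟩ := Finite.exists_le fun i ↦ (d.toOver.τ₀ + L i) / c i
  obtain ⟨τ₁, hτ₀'τ₁, hTτ₁⟩ : ∃ τ₁ : ℝ, τ₀' < τ₁ ∧ T ≤ τ₁ := ⟨max (τ₀' + 1) T, (lt_add_one _).trans_le (le_max_left _ _), le_max_right _ _⟩
  have hτ₀τ₁ : d.toOver.τ₀ ≤ τ₁ := hτ₀'.trans hτ₀'τ₁.le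
  have htilt : ∀ i, ∀ u ∈ (Kerr.exterior (M i) (a i) : Set E4), τ₁ < u 0 → d.toOver.τ₀ < Θ i u 0 := by
    intro i u hu hu0
    have h2 : (d.toOver.τ₀ + L i) / c i ≤ τ₁ := (hT i).trans hTτ₁
    rw [div_le_iff₀ (hc i)] at h2
    nlinarith [mul_lt_mul_of_pos_left hu0 (hc i), (abs_le.1 (hL i u hu)).1]
  -- the hole charts: late charts into `O`, then into `O'`
  have himgO : ∀ i, recutChart d M a Θ hmaps i '' (recutBackground d M a i).lateRegion τ₁ ⊆ O := by
    rintro i _ ⟨y, hy, rfl⟩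
    refine (d.toOver.isLateChart i).image_subset ⟨⟨_, hmaps i y.2⟩, ?_, rfl⟩
    show d.toOver.τ₀ < (poincareInv (d.motion i).1 (d.motion i).2
      (((d.motion i).1 : E4 ≃L[ℝ] E4) (Θ i (poincareInv (d.motion i).1 (d.motion i).2 y.1)) + (d.motion i).2)) 0
    rw [poincareInv_apply_add]; exact htilt i _ (mem_boostedKerrExterior.1 y.2) hy
  have hlateO : ∀ i, 𝒟.toSpacetime.IsLateChart (recutBackground d M a i) O τ₁ (recutChart d M a Θ hmaps i) :=
    fun i ↦ isLateChart_recut (d.adapted i) (d.motion i).1 (d.motion i).2 (d.toOver.isLateChart i)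
      (hr₀ i).le (hΘs i) (hinj i) (hiso i) (hmaps i) (htilt i) (himgO i)
  have hlate : ∀ i, 𝒟.toSpacetime.IsLateChart (recutBackground d M a i)
      (Summit.FinalStateConjecture.exteriorOf 𝒟.toCauchyDevelopment (recutCharted d M a Θ τ₁)) τ₁
      (recutChart d M a Θ hmaps i) := fun i ↦
    ⟨(hlateO i).contMDiff, (hlateO i).isOpenEmbedding,
      subset_exteriorOf_of_isOpen _ ((himgO i).trans hO.subset) (isOpen_image_of_isLateChart (hlateO i)) (by
        rw [recutCharted_eq d M a Θ hmaps]
        exact subset_union_of_subset_right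
          (subset_iUnion (fun i ↦ recutChart d M a Θ hmaps i '' (recutBackground d M a i).lateRegion τ₁) i) _)⟩
  -- the flat chart, re-based at `τ₁`
  have hflatimg : d.toOver.flatChart '' (Minkowski.backgroundOn d.toOver.flatDomain).lateRegion τ₁ ⊆ O :=
    (image_mono ((Minkowski.backgroundOn d.toOver.flatDomain).lateRegion_mono hτ₀τ₁)).trans
      d.toOver.isLateChart_flat.image_subset
  have hflatO : 𝒟.toSpacetime.IsLateChart (Minkowski.backgroundOn d.toOver.flatDomain) O τ₁ d.toOver.flatChart :=
    isLateChart_rebase _ d.toOver.isLateChart_flat hτ₀τ₁ (isOpen_lateRegion_backgroundOn _ _) hflatimg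
  have hflat : 𝒟.toSpacetime.IsLateChart (Minkowski.backgroundOn d.toOver.flatDomain)
      (Summit.FinalStateConjecture.exteriorOf 𝒟.toCauchyDevelopment (recutCharted d M a Θ τ₁)) τ₁ d.toOver.flatChart :=
    ⟨hflatO.contMDiff, hflatO.isOpenEmbedding, subset_exteriorOf_of_isOpen _ (hflatimg.trans hO.subset)
      (isOpen_image_of_isLateChart hflatO) subset_union_left⟩
  -- near-zone convergence for every radius, separation, excision
  have hconv' : ∀ i (R : ℝ), Tendsto (fun τ ↦ 𝒟.toSpacetime.truncDeviationCk (recutBackground d M a i)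
      (recutChart d M a Θ hmaps i) 2 R τ) atTop (𝓝 0) := fun i ↦ tendsto_truncDeviationCk_of_tendsto_atTop _ _ _ (hR' i) (hconv i)
  have hsep := separation_recut d M a c r₀ Θ hmaps hsub hc hr₀ (fun i ↦ (hΘs i).continuousOn) hΘm hΘe
  obtain ⟨ρ, hρ, hρdom⟩ := excision_transfer 𝒟.toSpacetime O 2 d a
  -- the covering clause at `τ₁` (`hcov` below) and exhaustiveness (ii) come from (ii) of the covering
  have hanti := exteriorOf_mono 𝒟.toCauchyDevelopment (recutCharted_anti d M a Θ hτ₀'τ₁.le)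
  -- honest radii: raise the growing radii `R'` of the covering to at least `max (r₊, 0) + 1`
  set R'' : Fin d.N → ℝ → ℝ := fun i τ ↦ max (R' i τ) (max (Kerr.rPlus (M i) (a i)) 0 + 1) with hR''
  have hR'le : ∀ i τ, R' i τ ≤ R'' i τ := fun i τ ↦ le_max_left _ _
  have hconv'' : ∀ i, Tendsto (fun τ ↦ 𝒟.toSpacetime.truncDeviationCk (recutBackground d M a i)
      (recutChart d M a Θ hmaps i) 2 (R'' i τ) τ) atTop (𝓝 0) := by
    refine fun i ↦ (hconv i).congr' ?_
    filter_upwards [(hR' i).eventually_ge_atTop (max (Kerr.rPlus (M i) (a i)) 0 + 1)] with τ hτ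
    simp only [hR'', max_eq_left hτ]; rfl
  have hlate_mono : ∀ τ₂, recutCertifiedLate d M a Θ R' τ₂ ⊆ recutCertifiedLate d M a Θ R'' τ₂ :=
    fun τ₂ ↦ union_subset_union le_rfl (iUnion_mono fun i ↦ recutImage_mono d Θ i
      (image_mono fun x hx ↦ ⟨hx.1, hx.2.trans (hR'le i _)⟩))
  have hslab_mono : ∀ τ₂, recutCertifiedSlab d M a Θ R' τ₂ ⊆ recutCertifiedSlab d M a Θ R'' τ₂ :=
    fun τ₂ ↦ union_subset_union le_rfl (iUnion_mono fun i ↦ recutImage_mono d Θ i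
      (image_mono ((recutBackground d M a i).truncTimeSlab_mono (hR'le i τ₂) τ₂)))
  refine ⟨_, recutDecomposition d M a Θ hmaps τ₁ (fun i ↦ (hsub i).pos) (fun i ↦ (hsub i).le) hlate hconv' hsep ρ hρ
    (hρdom τ₁ hτ₀τ₁) hflat (fun p hp ↦ LorentzianMetric.causalFuture_mono (recutCertifiedSlab_subset d M a Θ hmaps R' τ₁)
      (hii τ₁ hτ₀'τ₁ ⟨hanti hp.1, fun h ↦ hp.2 (recutCertifiedLate_subset d M a Θ hmaps R' τ₁ h)⟩)), hsub, ?_, ?_,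
    ⟨R'', fun i ↦ ⟨tendsto_atTop_mono (hR'le i) (hR' i), fun τ ↦ le_max_right _ _⟩, hconv'', fun τ₂ hτ₂ ↦ ?_⟩, horient.1,
    fun i ρ' ↦ ?_, ?_⟩
  · rw [charted_recutDecomposition]
  · -- the ray clause: `O ∩ I⁻(docCharted d) ⊆ O'`
    exact raysStayInClosure_mono 𝒟.toCauchyDevelopment (inter_chronologicalPast_docCharted_subset_exteriorOf_recutCharted
      𝒟.toCauchyDevelopment d hO hex hK hmaps hL hτ₀τ₁ hlateO hflatO) hrays
  · rw [certifiedLate_recutDecomposition, certifiedSlab_recutDecomposition]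
    exact fun p hp ↦ LorentzianMetric.causalFuture_mono (hslab_mono τ₂)
      (hii τ₂ (hτ₀'τ₁.trans hτ₂) ⟨hanti hp.1, fun h ↦ hp.2 (hlate_mono τ₂ h)⟩)
  · -- (ii) the push-forwards of `Λᵢ V_{Mᵢ,aᵢ}` by the recut hole charts are eventually future-directed
    show ∀ᶠ τ in atTop, ∀ x ∈ (recutBackground d M a i).truncTimeSlab ρ' τ,
      𝒟.timeOrientation.IsFutureDirected (mfderiv 𝓘(ℝ, E4) (𝓡 4) (recutChart d M a Θ hmaps i) x
        (((d.motion i).1 : E4 ≃L[ℝ] E4) (Kerr.timeVector (M i) (a i) (poincareInv (d.motion i).1 (d.motion i).2 x.1))))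
    have hΘd : ∀ u ∈ (Kerr.exterior (M i) (a i) : Set E4), DifferentiableAt ℝ (Θ i) u := fun u hu ↦
      ((hΘs i).differentiableOn (by simp)).differentiableAt ((Kerr.region _ _).isOpen.mem_nhds (hsubreg i hu))
    have hΦ : ContDiffOn ℝ ∞ (recutMap (d.motion i).1 (d.motion i).2 (Θ i)) ((recutBackground d M a i).domain : Set E4) :=
      (contDiffOn_conj (d.motion i).1 (d.motion i).2 (hΘs i)).mono fun z hz ↦ hsubreg i (mem_boostedKerrExterior.1 hz)
    -- chain rule: `d(ψᵢ ∘ recutMap Θᵢ)_x v = dψᵢ (Λ (dΘᵢ (Λ⁻¹ v)))`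
    have hchain : ∀ (x : (recutBackground d M a i).domain) (v : E4),
        mfderiv 𝓘(ℝ, E4) (𝓡 4) (recutChart d M a Θ hmaps i) x v =
          mfderiv 𝓘(ℝ, E4) (𝓡 4) (d.toOver.chart i) ⟨recutMap (d.motion i).1 (d.motion i).2 (Θ i) x.1, hmaps i x.2⟩
            (((d.motion i).1 : E4 ≃L[ℝ] E4) (fderiv ℝ (Θ i) (poincareInv (d.motion i).1 (d.motion i).2 x.1)
              (((d.motion i).1 : E4 ≃L[ℝ] E4).symm v))) := by
      intro x v
      have hd : mfderiv 𝓘(ℝ, E4) (𝓡 4) (recutChart d M a Θ hmaps i) x =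
          (mfderiv 𝓘(ℝ, E4) (𝓡 4) (d.toOver.chart i) ⟨recutMap (d.motion i).1 (d.motion i).2 (Θ i) x.1, hmaps i x.2⟩).comp
            (mfderiv 𝓘(ℝ, E4) 𝓘(ℝ, E4) (fun y : (recutBackground d M a i).domain ↦
              (⟨recutMap (d.motion i).1 (d.motion i).2 (Θ i) y.1, hmaps i y.2⟩ : (d.background i).domain)) x) :=
        mfderiv_comp x ((d.toOver.isLateChart i).contMDiff.mdifferentiableAt (by simp))
          ((contMDiff_readapt (hmaps i) hΦ).mdifferentiableAt (by simp))
      rw [hd, mfderiv_readapt (hmaps i) hΦ x]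
      show mfderiv 𝓘(ℝ, E4) (𝓡 4) (d.toOver.chart i) ⟨_, hmaps i x.2⟩ (fderiv ℝ (fun x ↦ ((d.motion i).1 : E4 ≃L[ℝ] E4)
        (Θ i (poincareInv (d.motion i).1 (d.motion i).2 x)) + (d.motion i).2) x.1 v) = _
      rw [fderiv_conj _ _ (hΘd _ (mem_boostedKerrExterior.1 x.2))]; rfl
    filter_upwards [eventually_isTimelike_boostedKerr 𝒟.toSpacetime (hsub i) (recutChart d M a Θ hmaps i) ρ' (hconv' i ρ'),
      eventually_gt_atTop τ₁] with τ hτ hττ₁ x hx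
    have hu : poincareInv (d.motion i).1 (d.motion i).2 x.1 ∈ (Kerr.exterior (M i) (a i) : Set E4) :=
      mem_boostedKerrExterior.1 x.2
    have hx0 : (poincareInv (d.motion i).1 (d.motion i).2 x.1) 0 = τ := hx.1
    have hmem : Θ i (poincareInv (d.motion i).1 (d.motion i).2 x.1) ∈ (d.adapted i).domain := hΘm i (hsubreg i hu)
    have htime : d.toOver.τ₀ < (d.background i).time (recutMap (d.motion i).1 (d.motion i).2 (Θ i) x.1) := by
      show d.toOver.τ₀ < (poincareInv (d.motion i).1 (d.motion i).2 (((d.motion i).1 : E4 ≃L[ℝ] E4)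
        (Θ i (poincareInv (d.motion i).1 (d.motion i).2 x.1)) + (d.motion i).2)) 0
      rw [poincareInv_apply_add]; exact htilt i _ hu (by rw [hx0]; exact hττ₁)
    have key : ∀ p : (d.adapted i).domain, p = ⟨Θ i (poincareInv (d.motion i).1 (d.motion i).2 x.1), hmem⟩ →
        (d.hole i).timeOrientation.IsFutureDirected (mfderiv 𝓘(ℝ, E4) (𝓡 4) (d.adapted i).toFun p (fderiv ℝ (Θ i)
          (poincareInv (d.motion i).1 (d.motion i).2 x.1) (Kerr.timeVector (M i) (a i) (poincareInv (d.motion i).1 (d.motion i).2 x.1)))) := by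
      rintro p rfl; exact hF5 i _ hu hmem
    have hTL : 𝒟.metric.IsTimelike (mfderiv 𝓘(ℝ, E4) (𝓡 4) (recutChart d M a Θ hmaps i) x
        (((d.motion i).1 : E4 ≃L[ℝ] E4) (Kerr.timeVector (M i) (a i) (poincareInv (d.motion i).1 (d.motion i).2 x.1)))) :=
      hτ x hx
    rw [hchain, ContinuousLinearEquiv.symm_apply_apply] at hTL
    have h := horient.2.1 i ⟨recutMap (d.motion i).1 (d.motion i).2 (Θ i) x.1, hmaps i x.2⟩ _ htime ?_ hTL
    · rw [hchain, ContinuousLinearEquiv.symm_apply_apply]; exact h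
    · rw [ContinuousLinearEquiv.symm_apply_apply]; exact key _ (Subtype.ext (poincareInv_apply_add _ _ _))
  · -- (iii) the push-forward of `∂₀` by the flat chart is eventually future-directed
    show ∀ᶠ τ in atTop, ∀ y ∈ (Minkowski.backgroundOn d.toOver.flatDomain).timeSlab τ,
      𝒟.timeOrientation.IsFutureDirected (mfderiv 𝓘(ℝ, E4) (𝓡 4) d.toOver.flatChart y (E4.basisVector 0))
    filter_upwards [eventually_isTimelike_flat 𝒟.toSpacetime (U := d.toOver.flatDomain) d.toOver.flatChart
      d.toOver.tendsto_deviationCk_flat, eventually_gt_atTop d.toOver.τ₀] with τ hτ hττ₀ y hy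
    have hy' : (y : E4) 0 = τ := hy
    exact horient.2.2 y (by rw [hy']; exact hττ₀) (hτ y hy)

end Summit.FinalStateConjecture.FinalStateConjecture.Theorems.SymplecticDualOfTheBomb

end
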